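import Summits.QuantumFields.BalabanUV.Beta.TorusBallMeanValue

/-!
# `Summit.QuantumFields.BalabanUV.Beta.MeanValueBinderOfPoissonBound` — the owner's binder `hMV` of file 16c
# (`MultiscaleRegularityOfMeanValue.hreg_of_meanValue` ∕ `real_sup_levelOp_inverse_le_of_meanValue`), VERBATIM, from ONE uniform
# pointwise bound on the Poisson kernels of the Euclidean lattice balls of the unit torus seen from their centres (the harmonic-measure
# bound (HMB) — road P3's ONE residual leaf); the constant is `C_MV = max(1, 6^d·K₀)` (step 4, the adapter)

HONEST FRAMING (page 1 of everything in this cell).  Discharging `FlowStep.BetaPertH` would make Bałaban's ultraviolet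
stability UNCONDITIONAL — a constructive-QFT result; it is NOT the continuum limit and NOT the Clay problem.  This module
discharges nothing of `BetaPertH`; it is [folklore] bookkeeping on the torus MODEL, kernel-checked, by CO-OWNER #3 of binder row D4
(unit `b2b-balaban-beta-d4-p3`, road P3 «reduction road», gen 12).  HONEST DEPENDENCY: continuum YM on T⁴ ⇐ BetaPertH ∧ nine spine
estimates (0/9 proved); BetaPertH ⇐ (D1) ∧ (D4) ∧ CAP+tail; G-an2-4 gates asym, D1 and NE2/3/4.

THE POINT.  File 16c turns the L¹ mean-value binder
  (MV)  `∀ x₀ r, (∀ μ, 2r+2 ≤ N_μ) → ∀ z ≥ 0, (∀ x, dist(x,x₀) ≤ r → 2d·z(x) ≤ Σ_μ (z(x+e_μ) + z(x−e_μ))) →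
        z(x₀) ≤ C_MV/(2r+1)^d · Σ_{dist(x,x₀) ≤ r} z(x)`,  `C_MV ≥ 1`,
into file 9b's datum `hreg` and the sup member (3.42)₁'s SHAPE for the MODEL.  THIS FILE derives (MV) in exactly that syntactic
shape, with `C_MV = max(1, 6^d·K₀)`, from the ONE hypothesis of road P3 (steps 1–3: `GraphHarmonicExtension`, `GraphPoissonKernel`,
`MeanValueFromPoisson`, `TorusBallMeanValue`):
  (HMB)  `∀ x₀ n, 1 ≤ n → (∀ μ, 2n+2 ≤ N_μ) → ∀ y, ⌊|y − x₀|⌋ = n → poisson₁ (C_n(x₀)) x₀ y ≤ K₀/n^{d−1}`,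
where `poisson₁` is the Poisson kernel (`GraphPoissonKernel.poisson`) of the UNIT-weight nearest-neighbour Laplacian of the torus and
`C_n(x₀) = {⌊|· − x₀|⌋ < n}` the Euclidean lattice ball — the harmonic-measure bound from the centre, for simple random walk on `ℤ^d`
the displayed Lemma 6.3.7 p. 130 of Lawler–Limic (2010) (their `H_{C_n}(·,y)` = «the unique function harmonic on `C_n` equal to
`δ(· − y)` on `∂C_n`», p. 123; `C_n = {|z| < n}` for simple random walk, p. 126), read on torus boxes below half the period.  (HMB) is
NOT proved and NOT asserted here (ABSOLUTE RULE): it is the hypothesis `hP`.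
* **`subsolution_of_normalized`** — the normalized sub-mean-value property `2d·z ≤ Σ_μ(z(·+e_μ) + z(·−e_μ))` is files 12∕14∕P3's
  `W·z ≤ Nz` for the unit weight (b05∕d4-p2 bond sums `sum_tgt_const` & co.);
* **`poisson_bound_of_eventually`** — the printed «for all n sufficiently large» is absorbed: a bound for `n ≥ n₀` gives (HMB) for
  all `n ≥ 1` with `K₀ = max(K, n₀^{d−1})` (`poisson ≤ 1`);
* **`hMV_of_poisson_bound`** — (HMB) ⟹ (MV) with `C_MV = max(1, 6^d·K₀)`: `r = 0` is `z(x₀) ≤ C_MV·z(x₀)`; `r ≥ 1` is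
  `TorusBallMeanValue.meanValue_box_of_poisson_bound` (`z(x₀) ≤ 2^dK₀/r^d·Σ_box z`) and `(2r+1)^d ≤ 3^d r^d`.
So O.2 item (ii-b) for the MODEL with constant weights = file 16c ∘ this file ∘ (HMB): ONE pointwise kernel bound about the FREE
Laplacian on Euclidean lattice balls, nothing else.

LOCATORS (shape only, nothing printed asserted; ABSOLUTE RULE): [Balaban1985BackgroundPropagators] Thm 3.1 (3.42) p. 397;
[Balaban1983RegularityDecay] Lemma 2.2 (2.17) pp. 577–578.  Row D4: NO class change (critical-path width 0; D4 DISCHARGE NO DATE);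
NOT BetaPertH, NOT continuum, NOT Clay, NOT summit progress.
-/

open scoped BigOperators
open Finset

namespace Summit.QuantumFields.BalabanUV.Beta.MeanValueBinderOfPoissonBound

open Literature.MathematicalPhysics.QuantumFieldTheory.Balaban1983to89
open Literature.MathematicalPhysics.QuantumFieldTheory.Balaban1983to89.B9Thm37GluePU (bsrc btgt bsrc_apply btgt_apply)
open B5TorusCover (UT)
open B5Leibniz121 (up dn)
open Summit.QuantumFields.BalabanUV.Beta.TorusBoxSupersolution (sum_tgt_const sum_src_const wsum_tgt_const wsum_src_const
  exists_unit_supersolution_box)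
open Summit.QuantumFields.BalabanUV.Beta.GraphPoissonKernel (poisson poisson_le_one)
open Summit.QuantumFields.BalabanUV.Beta.TorusBallMeanValue (erad dist_le_of_erad_le meanValue_box_of_poisson_bound)

noncomputable section

variable {d : ℕ} {N : Fin d → ℕ} [∀ i, NeZero (N i)]

/-- **The normalized sub-mean-value property is `W·z ≤ Nz` for the unit weight**: if `2d·z(x) ≤ Σ_μ (z(x+e_μ) + z(x−e_μ))` on the
box then, for the constant bond weight `c ≡ 1`, `W(x)·z(x) ≤ (Nz)(x)` there in files 12∕14∕P3's syntactic shape. [folklore] -/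
theorem subsolution_of_normalized (x₀ : UT N) (r : ℕ) (z : UT N → ℝ)
    (hz : ∀ x, dist x x₀ ≤ r → 2 * d * z x ≤ ∑ μ, (z (up x μ) + z (dn x μ))) :
    ∀ x ∈ univ.filter (fun x : UT N => dist x x₀ ≤ r),
      ((∑ b ∈ univ.filter (fun b : UT N × Fin d => btgt b = x), (fun _ : UT N × Fin d => (1 : ℝ)) b ^ 2) +
          ∑ b ∈ univ.filter (fun b : UT N × Fin d => bsrc b = x), (fun _ : UT N × Fin d => (1 : ℝ)) b ^ 2) * z x ≤
        ((∑ b ∈ univ.filter (fun b : UT N × Fin d => btgt b = x), (fun _ : UT N × Fin d => (1 : ℝ)) b ^ 2 * z (bsrc b)) +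
          ∑ b ∈ univ.filter (fun b : UT N × Fin d => bsrc b = x), (fun _ : UT N × Fin d => (1 : ℝ)) b ^ 2 * z (btgt b)) := by
  intro x hx
  have hcc : ∀ b : UT N × Fin d, (fun _ : UT N × Fin d => (1 : ℝ)) b = 1 := fun _ => rfl
  rw [sum_tgt_const hcc, sum_src_const hcc, wsum_tgt_const hcc, wsum_src_const hcc]
  have h := hz x (mem_filter.mp hx).2
  rw [Finset.sum_add_distrib] at h
  linarith

/-- **THE OWNER'S BINDER (MV) FROM THE HARMONIC-MEASURE BOUND (HMB).**  Unit torus `UT N`, `d ≥ 1`.  ASSUME (HMB) with a constant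
`K₀ ≥ 0`: for every centre `x₀`, every `n ≥ 1` with `2n + 2 ≤ N_μ` for all `μ`, and every `y` with `⌊|y − x₀|⌋ = n`,
`poisson₁ (C_n(x₀)) x₀ y ≤ K₀/n^{d−1}` (unit weight; `C_n(x₀) = {⌊|· − x₀|⌋ < n}`).  THEN (MV) in file 16c's shape with
`C_MV = max(1, 6^d·K₀)`: for every `x₀`, `r` with `2r + 2 ≤ N_μ`, and `z ≥ 0` with `2d·z(x) ≤ Σ_μ (z(x+e_μ) + z(x−e_μ))` whenever
`dist(x,x₀) ≤ r`: `z(x₀) ≤ C_MV/(2r+1)^d · Σ_{dist(x,x₀) ≤ r} z(x)`. [cite: Balaban1985BackgroundPropagators, Thm 3.1 (3.42) p.397] [folklore] -/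
theorem hMV_of_poisson_bound [NeZero d] {K₀ : ℝ} (hK₀ : 0 ≤ K₀)
    (hP : ∀ (x₀ : UT N) (n : ℕ), 1 ≤ n → (∀ μ, 2 * n + 2 ≤ N μ) → ∀ y : UT N, erad x₀ y = n →
      poisson bsrc btgt (fun _ : UT N × Fin d => (1 : ℝ)) (univ.filter (fun y => erad x₀ y < n)) x₀ y ≤ K₀ / (n : ℝ) ^ (d - 1)) :
    ∀ (x₀ : UT N) (r : ℕ), (∀ μ, 2 * r + 2 ≤ N μ) → ∀ z : UT N → ℝ, (∀ y, 0 ≤ z y) →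
      (∀ x, dist x x₀ ≤ r → 2 * d * z x ≤ ∑ μ, (z (up x μ) + z (dn x μ))) →
      z x₀ ≤ max 1 (6 ^ d * K₀) / (2 * r + 1 : ℝ) ^ d * ∑ x ∈ univ.filter (fun x : UT N => dist x x₀ ≤ r), z x := by
  intro x₀ r hr z hz0 hz
  have hx₀ : x₀ ∈ univ.filter (fun x : UT N => dist x x₀ ≤ r) := mem_filter.mpr ⟨mem_univ _, by simp⟩
  have hS0 : z x₀ ≤ ∑ x ∈ univ.filter (fun x : UT N => dist x x₀ ≤ r), z x :=
    Finset.single_le_sum (fun y _ => hz0 y) hx₀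
  have hSnn : 0 ≤ ∑ x ∈ univ.filter (fun x : UT N => dist x x₀ ≤ r), z x := Finset.sum_nonneg fun y _ => hz0 y
  rcases Nat.eq_zero_or_pos r with hr0 | hr1
  · -- `r = 0`: the box contains `x₀` and `C_MV ≥ 1`
    have h1 : (1 : ℝ) ≤ max 1 (6 ^ d * K₀) / (2 * r + 1 : ℝ) ^ d := by
      rw [hr0]
      simp only [Nat.cast_zero, mul_zero, zero_add, one_pow, div_one]
      exact le_max_left _ _
    calc z x₀ = 1 * z x₀ := (one_mul _).symm
      _ ≤ _ := mul_le_mul h1 hS0 (hz0 x₀) (le_trans zero_le_one h1)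
  · -- `r ≥ 1`: step 3 with the unit weight, then `(2r+1)^d ≤ 3^d r^d`
    have hr1' : 1 ≤ r := hr1
    have hstep := meanValue_box_of_poisson_bound (c := fun _ : UT N × Fin d => (1 : ℝ)) (c₀ := 1) (fun _ => rfl) one_ne_zero
      x₀ hr1' hr z hz0 (subsolution_of_normalized x₀ r z hz) hK₀
      (fun s hs1 hs2 y hy => hP x₀ s (by omega) (fun μ => by have := hr μ; omega) y hy)
    refine hstep.trans (mul_le_mul_of_nonneg_right ?_ hSnn)
    -- `2^d K₀ / r^d ≤ max(1, 6^d K₀) / (2r+1)^d`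
    have hrpos : (0 : ℝ) < r := by exact_mod_cast hr1
    have h2r1 : (0 : ℝ) < 2 * r + 1 := by positivity
    have hle : (2 * r + 1 : ℝ) ≤ 3 * r := by
      have : (1 : ℝ) ≤ r := by exact_mod_cast hr1'
      linarith
    rw [div_le_div_iff₀ (pow_pos hrpos d) (pow_pos h2r1 d)]
    calc 2 ^ d * K₀ * (2 * r + 1 : ℝ) ^ d ≤ 2 ^ d * K₀ * (3 * r) ^ d :=
          mul_le_mul_of_nonneg_left (pow_le_pow_left₀ h2r1.le hle d) (by positivity)
      _ = 6 ^ d * K₀ * (r : ℝ) ^ d := by rw [mul_pow, show (6 : ℝ) ^ d = 2 ^ d * 3 ^ d by rw [← mul_pow]; norm_num]; ring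
      _ ≤ max 1 (6 ^ d * K₀) * (r : ℝ) ^ d := mul_le_mul_of_nonneg_right (le_max_right _ _) (pow_nonneg hrpos.le d)

/-- **ABSORBING «n SUFFICIENTLY LARGE».**  A pointwise bound `poisson₁ (C_n(x₀)) x₀ y ≤ K/n^{d−1}` valid for `n ≥ n₀` only (the
literal form of the printed harmonic-measure lemma) yields (HMB) for ALL `n ≥ 1` with `K₀ = max(K, n₀^{d−1})`, because the Poisson
kernel is `≤ 1` (`GraphPoissonKernel.poisson_le_one`, the ball `C_n(x₀)` inheriting file 15b's box supersolution) and
`1 ≤ n₀^{d−1}/n^{d−1}` for `n ≤ n₀`.  So an ineffective threshold costs nothing but an ineffective (level-free) constant. [folklore] -/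
theorem poisson_bound_of_eventually [NeZero d] {K : ℝ} {n₀ : ℕ}
    (hP : ∀ (x₀ : UT N) (n : ℕ), n₀ ≤ n → (∀ μ, 2 * n + 2 ≤ N μ) → ∀ y : UT N, erad x₀ y = n →
      poisson bsrc btgt (fun _ : UT N × Fin d => (1 : ℝ)) (univ.filter (fun y => erad x₀ y < n)) x₀ y ≤ K / (n : ℝ) ^ (d - 1)) :
    ∀ (x₀ : UT N) (n : ℕ), 1 ≤ n → (∀ μ, 2 * n + 2 ≤ N μ) → ∀ y : UT N, erad x₀ y = n →
      poisson bsrc btgt (fun _ : UT N × Fin d => (1 : ℝ)) (univ.filter (fun y => erad x₀ y < n)) x₀ y ≤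
        max K ((n₀ : ℝ) ^ (d - 1)) / (n : ℝ) ^ (d - 1) := by
  intro x₀ n hn1 hn y hy
  have hnpos : (0 : ℝ) < (n : ℝ) ^ (d - 1) := pow_pos (by exact_mod_cast hn1) _
  by_cases hle : n₀ ≤ n
  · exact (hP x₀ n hle hn y hy).trans (div_le_div_of_nonneg_right (le_max_left _ _) hnpos.le)
  · -- small radii: `poisson ≤ 1 ≤ n₀^{d-1}/n^{d-1}`
    have hlt : n ≤ n₀ := by omega
    obtain ⟨w₀, hw₀0, -, hw₀⟩ := exists_unit_supersolution_box (c := fun _ : UT N × Fin d => (1 : ℝ)) (c₀ := 1)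
      (fun _ => rfl) one_ne_zero x₀ hn
    have hsub : ∀ x ∈ univ.filter (fun y : UT N => erad x₀ y < n), x ∈ univ.filter (fun x : UT N => dist x x₀ ≤ n) :=
      fun x hx => mem_filter.mpr ⟨mem_univ _, dist_le_of_erad_le x₀ x (mem_filter.mp hx).2.le⟩
    have h1 : poisson bsrc btgt (fun _ : UT N × Fin d => (1 : ℝ)) (univ.filter (fun y => erad x₀ y < n)) x₀ y ≤ 1 :=
      poisson_le_one bsrc btgt _ _ w₀ hw₀0 (fun x hx => hw₀ x (hsub x hx)) x₀ y
    refine h1.trans ?_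
    rw [le_div_iff₀ hnpos, one_mul]
    have h2 : (n : ℝ) ^ (d - 1) ≤ (n₀ : ℝ) ^ (d - 1) := pow_le_pow_left₀ (Nat.cast_nonneg _) (by exact_mod_cast hlt) _
    exact h2.trans (le_max_right _ _)

end

end Summit.QuantumFields.BalabanUV.Beta.MeanValueBinderOfPoissonBound
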